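import Summits.SmoothPoincare4.SmoothPoincare4.Theorems.EntropyRungRicciFlowBlowupLimitOfCompactness
import Summits.SmoothPoincare4.SmoothPoincare4.Theorems.EntropyRungChangGurskyYangOfGvPathFacts
import Literature.Geometry.Riemannian.ChangGurskyYang
import HarnessLib

/-!
# Route EntropyRung · crux `ChangGurskyYang` — the crux modulo its five one-fact leaves

Skeleton r9 of line `margerin-cone-hamilton-rails` (continuation lead c3, crux stmt-SmoothPoincare4-10834)
has exactly five `sorry`s, each ONE named Literature fact of the debt queue: Hamilton's compactness theorem
for Ricci flows in the time-zero-slice form `hamilton_compactness_ricciFlow_slice_four` (flow leaf: via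
`ricciFlow_blowupLimit_four_of_hamiltonCompactness`, `EntropyRungRicciFlowBlowupLimitOfCompactness.lean`,
p115618) and the four Gursky–Viaclovsky weighted-path facts `gurskyViaclovsky_gradientEstimate_weighted_four`,
`gurskyViaclovsky_hessianEstimate_weighted_four`, `gurskyViaclovsky_pathOpen_weighted_four`,
`gurskyViaclovsky_pathClosed_weighted_four` (σ₂ leaf: CGY Thm. 1.4 via
`changGurskyYang_theorem14_four_of_gvPathFacts`, `EntropyRungChangGurskyYangOfGvPathFacts.lean`, p108727).
This file is the one-line closing certificate of that state: the crux (both route decls) and the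
Literature fact `changGurskyYang_sphere_four` it restates, from the five facts. No `sorry`, no definition.
-/

noncomputable section

-- every `Summit.SmoothPoincare4.SmoothPoincare4.…` name repeats the summit = sub-problem segment (D-0017 layout)
set_option linter.dupNamespace false

namespace Summit.SmoothPoincare4.SmoothPoincare4.Theorems.MargerinRails

open Literature.Geometry.Riemannian
open Summit.SmoothPoincare4.SmoothPoincare4.Theses.EntropyRung (ChangGurskyYang)
open Summit.SmoothPoincare4.SmoothPoincare4.Theorems.GvContinuityPath
  (changGurskyYang_theorem14_four_of_gvPathFacts)

/-- **The crux `EntropyRung.ChangGurskyYang` from its five one-fact leaves**: Hamilton's 1995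
compactness theorem (time-zero slice, Morgan–Tian volume form) and the four Gursky–Viaclovsky
weighted-path facts (a priori `C¹`, `C²` estimates, openness, closedness of the solvable set) — the
composition of `ChangGurskyYang_of_hamiltonCompactness_of_theorem14` (p115618) with
`changGurskyYang_theorem14_four_of_gvPathFacts` (p108727); everything else of Chang–Gursky–Yang's
Theorem A (Chern–Gauss–Bonnet, `χ ≥ 2`, Margerin's sharp weak pinching along Hamilton's ODE, the tensor
maximum principle transfer, maximal existence, point picking, Perelman's no local collapsing, the round
recognition of the blow-up limit, Killing–Hopf, `π₁(ℝP⁴) ≠ 1`, the continuity method around the four GV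
facts) being theorems of the tree. [cite: ChangGurskyYang2003, §2, p. 121]
[cite: Hamilton1995Compactness, Thm. 1.2] [cite: GurskyViaclovsky2003, Props. 2, 5, 6 and §5] -/
theorem ChangGurskyYang_of_fiveFacts :
    hamilton_compactness_ricciFlow_slice_four →
    gurskyViaclovsky_gradientEstimate_weighted_four → gurskyViaclovsky_hessianEstimate_weighted_four →
    gurskyViaclovsky_pathOpen_weighted_four → gurskyViaclovsky_pathClosed_weighted_four →
    ChangGurskyYang :=
  fun hF hG hH hO hC ↦ ChangGurskyYang_of_hamiltonCompactness_of_theorem14 hF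
    (changGurskyYang_theorem14_four_of_gvPathFacts hG hH hO hC)

/-- The same for the item's second route decl `WeylBudget.ChangGurskyYang` (the same proposition).
[cite: ChangGurskyYang2003, Thm. A] -/
theorem ChangGurskyYang_weylBudget_of_fiveFacts :
    hamilton_compactness_ricciFlow_slice_four →
    gurskyViaclovsky_gradientEstimate_weighted_four → gurskyViaclovsky_hessianEstimate_weighted_four →
    gurskyViaclovsky_pathOpen_weighted_four → gurskyViaclovsky_pathClosed_weighted_four →
      Summit.SmoothPoincare4.SmoothPoincare4.Theses.WeylBudget.ChangGurskyYang :=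
  ChangGurskyYang_of_fiveFacts

/-- **The Literature named fact `changGurskyYang_sphere_four` (Chang–Gursky–Yang 2003, Thm. A, simply
connected `scal > 0` case — the text the crux inlines verbatim) from the same five facts**, for the
fact's other consumers (route WeylBudget, line `cgy-variance-pivot` of crux `CompactShrinkerGap`).
[cite: ChangGurskyYang2003, Thm. A and §2, p. 121] -/
theorem changGurskyYang_sphere_four_of_fiveFacts :
    hamilton_compactness_ricciFlow_slice_four →
    gurskyViaclovsky_gradientEstimate_weighted_four → gurskyViaclovsky_hessianEstimate_weighted_four →
    gurskyViaclovsky_pathOpen_weighted_four → gurskyViaclovsky_pathClosed_weighted_four →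
      changGurskyYang_sphere_four :=
  ChangGurskyYang_of_fiveFacts

end Summit.SmoothPoincare4.SmoothPoincare4.Theorems.MargerinRails

end
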